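import Mathlib
import Summits.AtomisticToContinuum.Crystallization.Theorems.SquareWellLayerCakeStackingFaultSparsityDefs
import Summits.AtomisticToContinuum.Crystallization.Theorems.SquareWellLayerCakeStackingFaultSparsityCompetitorInjective
import Summits.AtomisticToContinuum.Crystallization.Theorems.MinMeanCycleStackingLockBarlowEnergyIdentification
import Summits.AtomisticToContinuum.Crystallization.Theorems.MinMeanCycleStackingLockLockedBoxMinimiserLayerSums
import Literature.MathematicalPhysics.StatisticalMechanics.BarlowStackingEnergy
import Literature.MathematicalPhysics.StatisticalMechanics.BarlowBlockFlipLayers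
import Literature.MathematicalPhysics.StatisticalMechanics.TriangularLayerCounts
import Literature.MathematicalPhysics.StatisticalMechanics.TwoScaleShellSums
import Literature.MathematicalPhysics.StatisticalMechanics.LayerSumDecay
import Literature.MathematicalPhysics.StatisticalMechanics.LennardJonesClusters

/-!
# Exact-lattice ledger, I: the displaced lattice configuration (helper file)

Crux `StackingFaultSparsity` (item stmt-AtomisticToContinuum-14296, routes `SquareWellLayerCake` /
`LaminarSixThreeThree`), line `Sketch`, stub `stub_exactLatticeLedger` (survey obligation M3c+e, the
exact-lattice ledger of the cylinder block flip; landing file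
`SquareWellLayerCakeStackingFaultSparsityExactLatticeLedger.lean`, whose module docstring has the
overall map).

Generic facts about the displacement field `D` of the cylinder flip on the index set `ℤ³`
(`D q = σ_{q.1} • w` on the cylinder indices, `0` off them) and the pair change
`Δ q q' = V(|new pair|) - V(|old pair|)`: rigidly moved pairs do not change, every displacement is
`σ • w` with `σ ∈ {0, ±1}`, the displaced configuration is injective and `1/2`-separated (refined
lattice, `le_dist_barlowPos_add_zsmul`), vertical gaps bound distances below, `|V_LJ(r)| ≤ 6 r⁻⁶`
for `r ≥ 1/2`; lateral geometry of `latSq` (projection distance, triangle inequality, shifts are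
laterally `≤ 3/5`); summability of layer families, the shell sum over an injectively indexed family
(`TwoScaleShellSums`), injectivity of shifted layer families.  Carrier: `ledger_basics_carrier`.
-/

noncomputable section
namespace Summit.AtomisticToContinuum.Crystallization.Theorems.SquareWellLayerCake.StackingFaultSparsity
open Literature.MathematicalPhysics.StatisticalMechanics

/-! ## 0. Box parameters -/

/-- Box parameters are positive: `a ≥ 47/50`, `h ≥ (39/50)(47/50)`. [folklore] -/
theorem InBox.pos {a h : ℝ} (hbox : InBox a h) : 0 < a ∧ 0 < h := by
  obtain ⟨ha, -, hh, -⟩ := hbox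
  constructor <;> nlinarith

/-- Crude box bounds: `47/50 ≤ a ≤ 1`, `7/10 ≤ h ≤ 1`. [folklore] -/
theorem InBox.bounds {a h : ℝ} (hbox : InBox a h) : 47 / 50 ≤ a ∧ a ≤ 1 ∧ 7 / 10 ≤ h ∧ h ≤ 1 := by
  obtain ⟨ha, ha1, hh, hh1⟩ := hbox
  refine ⟨ha, ha1, by nlinarith, by nlinarith⟩

/-- On the box, `1/2 ≤ min (a/√3) h` (the separation of the refined lattice). [folklore] -/
theorem InBox.half_le_min {a h : ℝ} (hbox : InBox a h) : 1 / 2 ≤ min (a / √3) h := by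
  obtain ⟨ha, -, hh, -⟩ := hbox
  have h3 : (0 : ℝ) < √3 := by positivity
  have hs3 : √3 ≤ 2 * a := by
    rw [show (2 * a) = √((2 * a) ^ 2) by rw [Real.sqrt_sq (by linarith)]]
    exact Real.sqrt_le_sqrt (by nlinarith)
  refine le_min ?_ (by nlinarith)
  rw [le_div_iff₀ h3]
  linarith
/-! ## 2. The displaced lattice configuration: generic facts -/

/-- Pairs moved rigidly do not change. [folklore] -/
theorem pairChange_eq_zero_of_disp_eq {a h : ℝ} {s : ℤ → ℤ} {D : ℤ × ℤ × ℤ → (EuclideanSpace ℝ (Fin 3))}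
    {Δ : ℤ × ℤ × ℤ → ℤ × ℤ × ℤ → ℝ}
    (hΔ : ∀ q q', Δ q q' =
        lennardJones (dist (barlowPos a h s q.1 q.2.1 q.2.2 + D q)
            (barlowPos a h s q'.1 q'.2.1 q'.2.2 + D q')) -
          lennardJones (dist (barlowPos a h s q.1 q.2.1 q.2.2)
            (barlowPos a h s q'.1 q'.2.1 q'.2.2)))
    {q q' : ℤ × ℤ × ℤ} (hqq' : D q = D q') : Δ q q' = 0 := by
  rw [hΔ, hqq', dist_add_right, sub_self]

/-- `Δ` is symmetric. [folklore] -/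
theorem pairChange_symm {a h : ℝ} {s : ℤ → ℤ} {D : ℤ × ℤ × ℤ → (EuclideanSpace ℝ (Fin 3))}
    {Δ : ℤ × ℤ × ℤ → ℤ × ℤ × ℤ → ℝ}
    (hΔ : ∀ q q', Δ q q' =
        lennardJones (dist (barlowPos a h s q.1 q.2.1 q.2.2 + D q)
            (barlowPos a h s q'.1 q'.2.1 q'.2.2 + D q')) -
          lennardJones (dist (barlowPos a h s q.1 q.2.1 q.2.2)
            (barlowPos a h s q'.1 q'.2.1 q'.2.2)))
    (q q' : ℤ × ℤ × ℤ) : Δ q q' = Δ q' q := by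
  simp only [hΔ, dist_comm]

/-- Outside the block no point is displaced. [folklore] -/
theorem disp_eq_zero_of_not_mem {a h : ℝ} {s : ℤ → ℤ} {q₁ q₂ i₀ j₀ : ℤ} {ρ : ℝ}
    {D : ℤ × ℤ × ℤ → (EuclideanSpace ℝ (Fin 3))} (hD₀ : ∀ q, ¬ InCyl a h s q₁ q₂ i₀ j₀ ρ q.1 q.2.1 q.2.2 → D q = 0)
    {q : ℤ × ℤ × ℤ} (hq : q.1 ≤ q₁ ∨ q₂ ≤ q.1) : D q = 0 :=
  hD₀ q fun hc => by
    rcases hq with hq | hq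
    · exact absurd hc.1 (not_lt.2 hq)
    · exact absurd hc.2.1 (not_lt.2 hq)

/-- Every displacement is `σ • w` with `σ ∈ {0, 1, -1}`. [folklore] -/
theorem disp_eq_zsmul {a h : ℝ} {s : ℤ → ℤ} {q₁ q₂ i₀ j₀ : ℤ} {ρ : ℝ} {D : ℤ × ℤ × ℤ → (EuclideanSpace ℝ (Fin 3))}
    (hD₁ : ∀ q, InCyl a h s q₁ q₂ i₀ j₀ ρ q.1 q.2.1 q.2.2 →
      D q = ((shiftSign s q₁ q.1 : ℤ) : ℝ) • barlowOffset a)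
    (hD₀ : ∀ q, ¬ InCyl a h s q₁ q₂ i₀ j₀ ρ q.1 q.2.1 q.2.2 → D q = 0) (q : ℤ × ℤ × ℤ) :
    ∃ σ : ℤ, (σ = 0 ∨ σ = 1 ∨ σ = -1) ∧ D q = (σ : ℝ) • barlowOffset a := by
  by_cases hc : InCyl a h s q₁ q₂ i₀ j₀ ρ q.1 q.2.1 q.2.2
  · exact ⟨shiftSign s q₁ q.1, shiftSign_cases s q₁ q.1, hD₁ q hc⟩
  · exact ⟨0, Or.inl rfl, by rw [hD₀ q hc, Int.cast_zero, zero_smul]⟩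

/-- **The displaced configuration is injective** on the indices: the layer is read off the height,
and within a layer `p + σ w = p' + σ' w` forces `σ ≡ σ' (mod 3)` (second coordinate), hence
`σ = σ'` and `p = p'`. [folklore] -/
theorem disp_injective {a h : ℝ} {s : ℤ → ℤ} {q₁ q₂ i₀ j₀ : ℤ} {ρ : ℝ} {D : ℤ × ℤ × ℤ → (EuclideanSpace ℝ (Fin 3))}
    (ha : 0 < a) (hh : 0 < h)
    (hD₁ : ∀ q, InCyl a h s q₁ q₂ i₀ j₀ ρ q.1 q.2.1 q.2.2 →
      D q = ((shiftSign s q₁ q.1 : ℤ) : ℝ) • barlowOffset a)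
    (hD₀ : ∀ q, ¬ InCyl a h s q₁ q₂ i₀ j₀ ρ q.1 q.2.1 q.2.2 → D q = 0) {q q' : ℤ × ℤ × ℤ}
    (heq : barlowPos a h s q.1 q.2.1 q.2.2 + D q = barlowPos a h s q'.1 q'.2.1 q'.2.2 + D q') :
    q = q' := by
  obtain ⟨σ, hσ, hDq⟩ := disp_eq_zsmul hD₁ hD₀ q
  obtain ⟨σ', hσ', hDq'⟩ := disp_eq_zsmul hD₁ hD₀ q'
  rw [hDq, hDq'] at heq
  have e2 := congrArg (fun v : (EuclideanSpace ℝ (Fin 3)) => v 2) heq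
  have e1 := congrArg (fun v : (EuclideanSpace ℝ (Fin 3)) => v 1) heq
  have e0 := congrArg (fun v : (EuclideanSpace ℝ (Fin 3)) => v 0) heq
  simp only [barlowPos_add_zsmul_apply_two, barlowPos_add_zsmul_apply_one,
    barlowPos_add_zsmul_apply_zero] at e0 e1 e2
  have hn : q.1 = q'.1 := by
    have := mul_right_cancel₀ hh.ne' e2
    exact_mod_cast this
  rw [hn] at e0 e1
  have h3 : (√3 : ℝ) ≠ 0 := by positivity
  have e1' : (q.2.2 : ℝ) + (haggLabel s q'.1 + σ) / 3 = q'.2.2 + (haggLabel s q'.1 + σ') / 3 := by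
    have h' : a * √3 / 2 ≠ 0 := by positivity
    exact mul_left_cancel₀ h' e1
  have e0' : (q.2.1 : ℝ) + q.2.2 / 2 + (haggLabel s q'.1 + σ) / 2 =
      q'.2.1 + q'.2.2 / 2 + (haggLabel s q'.1 + σ') / 2 := mul_left_cancel₀ ha.ne' e0
  have i1 : 3 * q.2.2 + σ = 3 * q'.2.2 + σ' := by
    have : ((3 * q.2.2 + σ : ℤ) : ℝ) = ((3 * q'.2.2 + σ' : ℤ) : ℝ) := by push_cast; linarith
    exact_mod_cast this
  have i0 : 2 * q.2.1 + q.2.2 + σ = 2 * q'.2.1 + q'.2.2 + σ' := by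
    have : ((2 * q.2.1 + q.2.2 + σ : ℤ) : ℝ) = ((2 * q'.2.1 + q'.2.2 + σ' : ℤ) : ℝ) := by
      push_cast; linarith
    exact_mod_cast this
  have hσσ : σ = σ' := by omega
  refine Prod.ext hn (Prod.ext ?_ ?_) <;> omega

/-- **Distinct displaced points are `≥ 1/2` apart** (refined lattice, box parameters). [folklore] -/
theorem half_le_dist_disp {a h : ℝ} {s : ℤ → ℤ} {q₁ q₂ i₀ j₀ : ℤ} {ρ : ℝ} {D : ℤ × ℤ × ℤ → (EuclideanSpace ℝ (Fin 3))}
    (hbox : InBox a h)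
    (hD₁ : ∀ q, InCyl a h s q₁ q₂ i₀ j₀ ρ q.1 q.2.1 q.2.2 →
      D q = ((shiftSign s q₁ q.1 : ℤ) : ℝ) • barlowOffset a)
    (hD₀ : ∀ q, ¬ InCyl a h s q₁ q₂ i₀ j₀ ρ q.1 q.2.1 q.2.2 → D q = 0) {q q' : ℤ × ℤ × ℤ}
    (hne : q ≠ q') :
    1 / 2 ≤ dist (barlowPos a h s q.1 q.2.1 q.2.2 + D q) (barlowPos a h s q'.1 q'.2.1 q'.2.2 + D q') := by
  obtain ⟨ha, hh⟩ := InBox.pos hbox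
  have hne' : barlowPos a h s q.1 q.2.1 q.2.2 + D q ≠ barlowPos a h s q'.1 q'.2.1 q'.2.2 + D q' :=
    fun h0 => hne (disp_injective ha hh hD₁ hD₀ h0)
  obtain ⟨σ, -, hDq⟩ := disp_eq_zsmul hD₁ hD₀ q
  obtain ⟨σ', -, hDq'⟩ := disp_eq_zsmul hD₁ hD₀ q'
  rw [hDq, hDq'] at hne' ⊢
  exact (InBox.half_le_min hbox).trans (le_dist_barlowPos_add_zsmul a h s ha.le _ _ _ _ _ _ _ _ hne')

/-- Distinct lattice points are `≥ 1/2` apart (indeed `≥ min a h`). [folklore] -/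
theorem half_le_dist_old {a h : ℝ} (hbox : InBox a h) (s : ℤ → ℤ) {q q' : ℤ × ℤ × ℤ} (hne : q ≠ q') :
    1 / 2 ≤ dist (barlowPos a h s q.1 q.2.1 q.2.2) (barlowPos a h s q'.1 q'.2.1 q'.2.2) := by
  obtain ⟨ha1, -, hh1, -⟩ := hbox
  refine le_trans (le_min (by linarith) (by nlinarith))
    (le_dist_barlowPos a h s (by linarith) (by nlinarith) (k := q.1) (i := q.2.1) (j := q.2.2)
      (k' := q'.1) (i' := q'.2.1) (j' := q'.2.2) ?_)
  intro h0
  apply hne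
  simp only [Prod.mk.injEq] at h0
  exact Prod.ext h0.1 (Prod.ext h0.2.1 h0.2.2)

/-- `|V_LJ(r)| ≤ 6 r⁻⁶` for `r ≥ 1/2`. [folklore] -/
theorem abs_lennardJones_le_six {r : ℝ} (hr : 1 / 2 ≤ r) : |lennardJones r| ≤ 6 * r⁻¹ ^ 6 := by
  have hr0 : 0 < r := by linarith
  have h1 := LockedBoxMinimiser.abs_lennardJones_le hr0.le
  have hu : r⁻¹ ≤ 2 := by rw [inv_le_comm₀ hr0 (by norm_num)]; linarith
  have hu0 : 0 ≤ r⁻¹ := inv_nonneg.2 hr0.le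
  have hu6 : r⁻¹ ^ 6 ≤ 2 ^ 6 := pow_le_pow_left₀ hu0 hu 6
  have h12 : r⁻¹ ^ 12 = r⁻¹ ^ 6 * r⁻¹ ^ 6 := by ring
  have h60 : 0 ≤ r⁻¹ ^ 6 := by positivity
  rw [h12] at h1
  nlinarith [mul_le_mul_of_nonneg_right hu6 h60]

/-- The vertical gap bounds the distance of displaced points below. [folklore] -/
theorem vertical_le_dist_disp {a h : ℝ} {s : ℤ → ℤ} {q₁ q₂ i₀ j₀ : ℤ} {ρ : ℝ} {D : ℤ × ℤ × ℤ → (EuclideanSpace ℝ (Fin 3))}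
    (hD₁ : ∀ q, InCyl a h s q₁ q₂ i₀ j₀ ρ q.1 q.2.1 q.2.2 →
      D q = ((shiftSign s q₁ q.1 : ℤ) : ℝ) • barlowOffset a)
    (hD₀ : ∀ q, ¬ InCyl a h s q₁ q₂ i₀ j₀ ρ q.1 q.2.1 q.2.2 → D q = 0) (q q' : ℤ × ℤ × ℤ) :
    |((q.1 : ℝ) - q'.1) * h| ≤
      dist (barlowPos a h s q.1 q.2.1 q.2.2 + D q) (barlowPos a h s q'.1 q'.2.1 q'.2.2 + D q') := by
  obtain ⟨σ, -, hDq⟩ := disp_eq_zsmul hD₁ hD₀ q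
  obtain ⟨σ', -, hDq'⟩ := disp_eq_zsmul hD₁ hD₀ q'
  rw [hDq, hDq']
  exact abs_sub_mul_le_dist_barlowPos_add_zsmul a h s _ _ _ _ _ _ _ _

/-- The vertical gap bounds the distance of lattice points below. [folklore] -/
theorem vertical_le_dist_old (a h : ℝ) (s : ℤ → ℤ) (q q' : ℤ × ℤ × ℤ) :
    |((q.1 : ℝ) - q'.1) * h| ≤ dist (barlowPos a h s q.1 q.2.1 q.2.2) (barlowPos a h s q'.1 q'.2.1 q'.2.2) := by
  have h0 := abs_sub_mul_le_dist_barlowPos_add_zsmul a h s q.1 q.2.1 q.2.2 0 q'.1 q'.2.1 q'.2.2 0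
  simpa using h0

/-! ## 2b. Lateral geometry -/

/-- `latSq` is symmetric. [folklore] -/
theorem latSq_comm (p c : (EuclideanSpace ℝ (Fin 3))) : latSq p c = latSq c p := by
  unfold latSq; ring

/-- `√latSq` is the distance of the lateral projections. [folklore] -/
theorem sqrt_latSq_eq_dist (p c : (EuclideanSpace ℝ (Fin 3))) :
    √(latSq p c) = dist ((!₂[p 0, p 1]) : EuclideanSpace ℝ (Fin 2)) (!₂[c 0, c 1]) := by
  rw [dist_lateral_eq_sqrt]; rfl

/-- Lateral triangle inequality. [folklore] -/
theorem sqrt_latSq_triangle (p q r : (EuclideanSpace ℝ (Fin 3))) : √(latSq p r) ≤ √(latSq p q) + √(latSq q r) := by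
  rw [sqrt_latSq_eq_dist, sqrt_latSq_eq_dist, sqrt_latSq_eq_dist]
  exact dist_triangle _ _ _

/-- The distance dominates the lateral distance. [folklore] -/
theorem sqrt_latSq_le_dist (p q : (EuclideanSpace ℝ (Fin 3))) : √(latSq p q) ≤ dist p q := by
  have h : latSq p q ≤ dist p q ^ 2 := by
    rw [EuclideanSpace.dist_sq_eq, Fin.sum_univ_three, Real.dist_eq, Real.dist_eq, Real.dist_eq,
      sq_abs, sq_abs, sq_abs, latSq]
    nlinarith [sq_nonneg (p 2 - q 2)]
  calc √(latSq p q) ≤ √(dist p q ^ 2) := Real.sqrt_le_sqrt h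
    _ = dist p q := Real.sqrt_sq dist_nonneg

/-- **The displacements are laterally short**: `√latSq (x + D q) x ≤ 3/5` (`‖σ w‖² = σ² a²/3 ≤ 1/3`).
[folklore] -/
theorem sqrt_latSq_disp_le {a h : ℝ} {s : ℤ → ℤ} {q₁ q₂ i₀ j₀ : ℤ} {ρ : ℝ} {D : ℤ × ℤ × ℤ → (EuclideanSpace ℝ (Fin 3))}
    (hbox : InBox a h)
    (hD₁ : ∀ q, InCyl a h s q₁ q₂ i₀ j₀ ρ q.1 q.2.1 q.2.2 →
      D q = ((shiftSign s q₁ q.1 : ℤ) : ℝ) • barlowOffset a)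
    (hD₀ : ∀ q, ¬ InCyl a h s q₁ q₂ i₀ j₀ ρ q.1 q.2.1 q.2.2 → D q = 0) (q : ℤ × ℤ × ℤ) (x : (EuclideanSpace ℝ (Fin 3))) :
    √(latSq (x + D q) x) ≤ 3 / 5 := by
  obtain ⟨σ, hσ, hDq⟩ := disp_eq_zsmul hD₁ hD₀ q
  obtain ⟨ha0, ha1, -, -⟩ := InBox.bounds hbox
  rw [hDq]
  have h3 : (√3 : ℝ) ^ 2 = 3 := Real.sq_sqrt (by norm_num)
  have hσ2 : (σ : ℝ) ^ 2 ≤ 1 := by rcases hσ with rfl | rfl | rfl <;> norm_num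
  have key : latSq (x + (σ : ℝ) • barlowOffset a) x = (σ : ℝ) ^ 2 * a ^ 2 / 3 := by
    simp [latSq, barlowOffset]
    linear_combination ((σ : ℝ) ^ 2 * a ^ 2 / 36) * h3
  rw [key]
  have ha2 : a ^ 2 ≤ 1 := by nlinarith
  have hσa : (σ : ℝ) ^ 2 * a ^ 2 ≤ 1 := by
    nlinarith [mul_le_mul hσ2 ha2 (sq_nonneg a) zero_le_one]
  calc √((σ : ℝ) ^ 2 * a ^ 2 / 3) ≤ √((3 / 5) ^ 2) := Real.sqrt_le_sqrt (by nlinarith)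
    _ = 3 / 5 := Real.sqrt_sq (by norm_num)

/-! ## 2c. Tools for the window-versus-full-layer remainder -/

/-- **Layer families of Lennard-Jones terms are summable**: seen from the shifted site
`barlowPos m i j + σ w`, the family `(i', j') ↦ V_LJ(|site - (barlowPos n i' j' + τ w)|)` of another
layer `n ≠ m` is summable (uniformly bounded partial sums of absolute values,
`LayerSumDecay.sum_abs_lennardJones_layerVec_le`). [folklore] -/
theorem summable_lennardJones_shift_layer {a h : ℝ} (ha : 0 < a) (hh : 0 < h) (s : ℤ → ℤ)
    (m i j n σ τ : ℤ) (hnm : n ≠ m) :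
    Summable (fun ij : ℤ × ℤ => lennardJones (dist (barlowPos a h s m i j + (σ : ℝ) • barlowOffset a)
      (barlowPos a h s n ij.1 ij.2 + (τ : ℝ) • barlowOffset a))) := by
  have hk : n - m ≠ 0 := sub_ne_zero.2 hnm
  have hg : Summable (fun ij : ℤ × ℤ =>
      |lennardJones ‖layerVec a h (haggLabel s n - haggLabel s m + (τ - σ)) (n - m) ij.1 ij.2‖|) :=
    summable_of_sum_le (fun _ => abs_nonneg _)
      (sum_abs_lennardJones_layerVec_le ha hh le_rfl le_rfl _ hk)
  have he := (Equiv.summable_iff (Equiv.subRight ((i, j) : ℤ × ℤ))).2 hg.of_abs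
  refine he.congr fun ij => ?_
  simp only [Function.comp_apply, Equiv.subRight_apply, Prod.fst_sub, Prod.snd_sub]
  rw [dist_comm, dist_eq_norm, barlowPos_add_sub_barlowPos_add]

/-- **Two-scale shell sum over an injectively indexed family** (`sum_abs_lennardJones_le_two_scale`,
`η = 1/2`): `∑_{i ∈ T} |V_LJ(|p - P i|)| ≤ 11000 L⁻³` if the `P i`, `i ∈ T`, are distinct, pairwise
`≥ 1/2` apart and all `≥ L ≥ 1/2` from `p`. [folklore] -/
theorem sum_abs_lennardJones_family_le {ι : Type*} [DecidableEq ι] (T : Finset ι) (P : ι → (EuclideanSpace ℝ (Fin 3))) (p : (EuclideanSpace ℝ (Fin 3)))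
    {L : ℝ} (hL : 1 / 2 ≤ L) (hinj : Set.InjOn P T)
    (hsep : ∀ i ∈ T, ∀ j ∈ T, i ≠ j → 1 / 2 ≤ dist (P i) (P j))
    (hfar : ∀ i ∈ T, L ≤ dist p (P i)) :
    ∑ i ∈ T, |lennardJones (dist p (P i))| ≤ 11000 * L⁻¹ ^ 3 := by
  classical
  have hconst : ((1 / 2 : ℝ)⁻¹ ^ 6 / 12 + 1 / 6) * (250 * (1 / 2 : ℝ)⁻¹ ^ 3 * L⁻¹ ^ 3) =
      11000 * L⁻¹ ^ 3 := by norm_num; ring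
  rw [← Finset.sum_image (f := fun z => |lennardJones (dist p z)|) hinj, ← hconst]
  refine sum_abs_lennardJones_le_two_scale _ _ (by norm_num) hL ?_ ?_
  · intro z hz w hw hne
    obtain ⟨i, hi, rfl⟩ := Finset.mem_image.1 hz
    obtain ⟨j, hj, rfl⟩ := Finset.mem_image.1 hw
    exact hsep i hi j hj (fun h0 => hne (by rw [h0]))
  · intro z hz
    obtain ⟨i, hi, rfl⟩ := Finset.mem_image.1 hz
    exact hfar i hi

/-- `√latSq (x + σ w) x ≤ 3/5` for `σ ∈ {0, ±1}` (box parameters). [folklore] -/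
theorem sqrt_latSq_zsmul_le {a h : ℝ} (hbox : InBox a h) {σ : ℤ} (hσ : σ = 0 ∨ σ = 1 ∨ σ = -1) (x : (EuclideanSpace ℝ (Fin 3))) :
    √(latSq (x + (σ : ℝ) • barlowOffset a) x) ≤ 3 / 5 := by
  obtain ⟨ha0, ha1, -, -⟩ := InBox.bounds hbox
  have h3 : (√3 : ℝ) ^ 2 = 3 := Real.sq_sqrt (by norm_num)
  have hσ2 : (σ : ℝ) ^ 2 ≤ 1 := by rcases hσ with rfl | rfl | rfl <;> norm_num
  have key : latSq (x + (σ : ℝ) • barlowOffset a) x = (σ : ℝ) ^ 2 * a ^ 2 / 3 := by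
    simp [latSq, barlowOffset]
    linear_combination ((σ : ℝ) ^ 2 * a ^ 2 / 36) * h3
  rw [key]
  have ha2 : a ^ 2 ≤ 1 := by nlinarith
  have hσa : (σ : ℝ) ^ 2 * a ^ 2 ≤ 1 := by
    nlinarith [mul_le_mul hσ2 ha2 (sq_nonneg a) zero_le_one]
  calc √((σ : ℝ) ^ 2 * a ^ 2 / 3) ≤ √((3 / 5) ^ 2) := Real.sqrt_le_sqrt (by nlinarith)
    _ = 3 / 5 := Real.sqrt_sq (by norm_num)

/-- `‖σ w‖ ≤ 3/5` for `σ ∈ {0, ±1}` (box parameters). [folklore] -/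
theorem norm_zsmul_barlowOffset_le {a h : ℝ} (hbox : InBox a h) {σ : ℤ} (hσ : σ = 0 ∨ σ = 1 ∨ σ = -1) :
    ‖(σ : ℝ) • barlowOffset a‖ ≤ 3 / 5 := by
  obtain ⟨ha0, ha1, -, -⟩ := InBox.bounds hbox
  rcases hσ with rfl | hσ
  · rw [Int.cast_zero, zero_smul, norm_zero]; norm_num
  · exact norm_smul_barlowOffset_le (by linarith) ha1 hσ

/-- **Shifted layer families are injective**: `(n, i, j) ↦ barlowPos n i j + τ_n • w`, with a shift
depending only on the layer, is injective (read the layer off the height, then cancel the common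
shift). [folklore] -/
theorem shiftFamily_injective {a h : ℝ} (ha : 0 < a) (hh : 0 < h) (s : ℤ → ℤ) (τ : ℤ → ℤ)
    {q q' : ℤ × ℤ × ℤ}
    (heq : barlowPos a h s q.1 q.2.1 q.2.2 + ((τ q.1 : ℤ) : ℝ) • barlowOffset a =
      barlowPos a h s q'.1 q'.2.1 q'.2.2 + ((τ q'.1 : ℤ) : ℝ) • barlowOffset a) : q = q' := by
  have e2 := congrArg (fun v : (EuclideanSpace ℝ (Fin 3)) => v 2) heq
  simp only [barlowPos_add_zsmul_apply_two] at e2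
  have hn : q.1 = q'.1 := by
    have := mul_right_cancel₀ hh.ne' e2
    exact_mod_cast this
  rw [hn] at heq
  have h1 := add_right_cancel heq
  have h2 := barlowPos_injective ha hh s (a₁ := (q'.1, q.2.1, q.2.2)) (a₂ := q') h1
  calc q = (q.1, q.2.1, q.2.2) := rfl
    _ = (q'.1, q.2.1, q.2.2) := by rw [hn]
    _ = q' := h2

/-- **Carrier of the basics file** (colon form of `half_le_dist_disp`, registered as a sub-stub of
line `Sketch` so that this helper file lands under `--supports`): distinct points of the displaced
exact-lattice configuration are `≥ 1/2` apart on the box. [folklore] -/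
theorem ledger_basics_carrier :
    ∀ (a h : ℝ) (s : ℤ → ℤ) (q₁ q₂ i₀ j₀ : ℤ) (ρ : ℝ) (D : ℤ × ℤ × ℤ → (EuclideanSpace ℝ (Fin 3))), InBox a h →
      (∀ q, InCyl a h s q₁ q₂ i₀ j₀ ρ q.1 q.2.1 q.2.2 →
        D q = ((shiftSign s q₁ q.1 : ℤ) : ℝ) • barlowOffset a) →
      (∀ q, ¬ InCyl a h s q₁ q₂ i₀ j₀ ρ q.1 q.2.1 q.2.2 → D q = 0) →
      ∀ q q' : ℤ × ℤ × ℤ, q ≠ q' →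
        1 / 2 ≤ dist (barlowPos a h s q.1 q.2.1 q.2.2 + D q) (barlowPos a h s q'.1 q'.2.1 q'.2.2 + D q') :=
  fun _ _ _ _ _ _ _ _ _ hbox hD₁ hD₀ _ _ hne => half_le_dist_disp hbox hD₁ hD₀ hne

end Summit.AtomisticToContinuum.Crystallization.Theorems.SquareWellLayerCake.StackingFaultSparsity

end
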